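import Literature.IUT.HodgeArakelov.ThetaSettingDeltaCharacteristicGenuine
import Literature.IUT.HodgeArakelov.AbsTopMonoidsGenuineOfSetting
import Literature.IUT.HodgeArakelov.AbsTopMonoidsGenuineOfSettingPadicClosure
import HarnessLib

/-!
# CAPSTONE: the GENUINE `AbsTopMonoids` producer of [IUTchII] Ex 1.8 at the GENUINE setting of the Tate curve,
# modulo exactly {«`Π^tp_X → G_K` open», ONE [AbsTopI] Thm 2.6 (v) regime on a completion package}

S. Mochizuki, *Inter-universal Teichmüller theory II*, §1, Example 1.8 (i)–(iv) (kurims pp. 35–39)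
[claim: Mochizuki2012, status: disputed].  Assembly (proof-only, no new definitions) of abc-iut-w5-d233's three files:
`ThetaSettingDeltaCharacteristicGenuine` ((H1) at `ThetaSetting.ofDoubleUnderline` ⟸ ∃ compatible MLF completion
package with `Δ_E` tfg ∧ `CoinvariantRankConstant` — FACT-LIST F-0001 —, the package half PROVED),
`AbsTopMonoidsGenuineOfSetting` / `…PadicClosure` (L6-t13's `genuineOfModel` instantiated with the setting's OWN MLF
closure datum and Galois identification, (H2) ⟸ «aug open»):

* `AbsTopMonoids.genuineOfDoubleUnderline_of_package` / `genuineOfDoubleUnderlinePadic_of_package` — the genuine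
  producer at the genuine setting from `hopen` + `h : ∃ package in the Thm 2.6 (v) regime`;
* `AbsTopMonoids.exists_genuine_ofDoubleUnderline_of_package` (+ `Padic` twin) — ∃-form recording the monoid.

HONEST SCOPE: the two remaining named inputs are genuine-models-only / FACT-LIST items of print ([SemiAnbd] Ex. 3.10
read topologically; [AbsAnab] Lemma 1.1.4 (ii) + [AbsTopI] Prop 2.2 for the profinite `Π_{X̲̲_K}`); `Ism` side of the
producer degenerate (B9 (d), L6-d2's line); no curve / theta setting asserted to exist; nothing here bears on
[IUTchIII] Cor. 3.12; no side is taken; typed ≠ proved elsewhere.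
-/

noncomputable section

namespace Literature.IUT.HodgeArakelov

open Literature.AnabelianGeometry.AbsoluteAnabelian
open Literature.AnabelianGeometry.EtaleTheta Literature.AnabelianGeometry.SemiGraphs
open scoped Literature.AnabelianGeometry.EtaleTheta

namespace AbsTopMonoids

variable {p : ℕ} [Fact p.Prime] {D : Literature.AnabelianGeometry.EtaleTheta.ThetaSetting p}
  {ED : D.EtaleThetaData} {l : ℕ} (C : ED.DoubleUnderline l) {N : ℕ+} (μ : D.CyclotomeMod l N)
  (hC : D.Compat) (hS : D.Sec2Hyps) (hl : l.Prime) (hp2 : p ≠ 2) (hpl : p ≠ l)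
  (hζ : ∃ ζ : D.K, IsPrimitiveRoot ζ (4 * l)) {η : (C.thetaEnvData μ hC hS).PiYdd → MuN p N}
  (hη : η ∈ (C.thetaEnvData μ hC hS).thetaCocycles)

/-- **The genuine producer at the genuine setting, over `(K, AlgebraicClosure K)`, from «aug open» + ONE regime
package.** [claim: Mochizuki2012, status: disputed] (IUTchII §1 Ex 1.8 (ii), kurims p.36) -/
def genuineOfDoubleUnderline_of_package
    (hopen : IsOpenMap fun x : D.PiTemp => (⟨D.aug x, D.aug_mem_GK x⟩ : D.GK))
    (h : ∃ (E : FundamentalExtension.{0}) (_ : E.MLFBase)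
      (ι : (ThetaSetting.ofDoubleUnderline C μ hC hS hl hp2 hpl hζ hη).PiX →ₜ* E.arith)
      (g : (ThetaSetting.ofDoubleUnderline C μ hC hS hl hp2 hpl hζ hη).Gk →* E.gal),
      IsProfiniteCompletion ι ∧ Function.Injective g ∧
        (∀ x, E.aug (ι x) = g ((ThetaSetting.ofDoubleUnderline C μ hC hS hl hp2 hpl hζ hη).aug x)) ∧
        IsTopologicallyFinitelyGenerated E.geom ∧ E.CoinvariantRankConstant) :
    AbsTopMonoids (ThetaSetting.ofDoubleUnderline C μ hC hS hl hp2 hpl hζ hη) :=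
  genuineOfDoubleUnderline_of_isOpenMap C μ hC hS hl hp2 hpl hζ hη hopen
    (ThetaSetting.deltaX_characteristic_ofDoubleUnderline_of_exists_package C μ hC hS hl hp2 hpl hζ hη h)

/-- **The genuine producer at the genuine setting, over `(K, ℚ̄_p, ε = id)`, from «aug open» + ONE regime package.**
[claim: Mochizuki2012, status: disputed] (IUTchII §1 Ex 1.8 (ii), kurims p.36) -/
def genuineOfDoubleUnderlinePadic_of_package
    (hopen : IsOpenMap fun x : D.PiTemp => (⟨D.aug x, D.aug_mem_GK x⟩ : D.GK))
    (h : ∃ (E : FundamentalExtension.{0}) (_ : E.MLFBase)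
      (ι : (ThetaSetting.ofDoubleUnderline C μ hC hS hl hp2 hpl hζ hη).PiX →ₜ* E.arith)
      (g : (ThetaSetting.ofDoubleUnderline C μ hC hS hl hp2 hpl hζ hη).Gk →* E.gal),
      IsProfiniteCompletion ι ∧ Function.Injective g ∧
        (∀ x, E.aug (ι x) = g ((ThetaSetting.ofDoubleUnderline C μ hC hS hl hp2 hpl hζ hη).aug x)) ∧
        IsTopologicallyFinitelyGenerated E.geom ∧ E.CoinvariantRankConstant) :
    AbsTopMonoids (ThetaSetting.ofDoubleUnderline C μ hC hS hl hp2 hpl hζ hη) :=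
  genuineOfDoubleUnderlinePadic_of_isOpenMap C μ hC hS hl hp2 hpl hζ hη hopen
    (ThetaSetting.deltaX_characteristic_ofDoubleUnderline_of_exists_package C μ hC hS hl hp2 hpl hζ hη h)

/-- **∃-form**: under «aug open» and ONE regime package, the interface `AbsTopMonoids` of [IUTchII] Ex 1.8 is
inhabited at the genuine setting by a producer whose monoid at every isomorph of `G_K` IS `𝒪^⊳_{K̄_K}` of the
setting's field. [claim: Mochizuki2012, status: disputed] (IUTchII §1 Ex 1.8 (ii), kurims p.36) -/
theorem exists_genuine_ofDoubleUnderline_of_package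
    (hopen : IsOpenMap fun x : D.PiTemp => (⟨D.aug x, D.aug_mem_GK x⟩ : D.GK))
    (h : ∃ (E : FundamentalExtension.{0}) (_ : E.MLFBase)
      (ι : (ThetaSetting.ofDoubleUnderline C μ hC hS hl hp2 hpl hζ hη).PiX →ₜ* E.arith)
      (g : (ThetaSetting.ofDoubleUnderline C μ hC hS hl hp2 hpl hζ hη).Gk →* E.gal),
      IsProfiniteCompletion ι ∧ Function.Injective g ∧
        (∀ x, E.aug (ι x) = g ((ThetaSetting.ofDoubleUnderline C μ hC hS hl hp2 hpl hζ hη).aug x)) ∧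
        IsTopologicallyFinitelyGenerated E.geom ∧ E.CoinvariantRankConstant) :
    ∃ A : AbsTopMonoids (ThetaSetting.ofDoubleUnderline C μ hC hS hl hp2 hpl hζ hη),
      ∀ G, A.Otri G =
        (ModelMLFGaloisData.galois D.toTemperedCurve.mlfClosure.k D.toTemperedCurve.mlfClosure.K).tmPair.M :=
  ⟨genuineOfDoubleUnderline_of_package C μ hC hS hl hp2 hpl hζ hη hopen h, fun _ => rfl⟩

/-- **∃-form over `(K, ℚ̄_p)`**: the same with monoid `𝒪^⊳_{ℚ̄_p}` (non-zero integers of the ambient `ℚ̄_p` over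
`𝒪_K`). [claim: Mochizuki2012, status: disputed] (IUTchII §1 Ex 1.8 (ii), kurims p.36) -/
theorem exists_genuinePadic_ofDoubleUnderline_of_package
    (hopen : IsOpenMap fun x : D.PiTemp => (⟨D.aug x, D.aug_mem_GK x⟩ : D.GK))
    (h : ∃ (E : FundamentalExtension.{0}) (_ : E.MLFBase)
      (ι : (ThetaSetting.ofDoubleUnderline C μ hC hS hl hp2 hpl hζ hη).PiX →ₜ* E.arith)
      (g : (ThetaSetting.ofDoubleUnderline C μ hC hS hl hp2 hpl hζ hη).Gk →* E.gal),
      IsProfiniteCompletion ι ∧ Function.Injective g ∧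
        (∀ x, E.aug (ι x) = g ((ThetaSetting.ofDoubleUnderline C μ hC hS hl hp2 hpl hζ hη).aug x)) ∧
        IsTopologicallyFinitelyGenerated E.geom ∧ E.CoinvariantRankConstant) :
    ∃ A : AbsTopMonoids (ThetaSetting.ofDoubleUnderline C μ hC hS hl hp2 hpl hζ hη),
      ∀ G, A.Otri G =
        (ModelMLFGaloisData.galois D.toTemperedCurve.mlfClosurePadic.k
          D.toTemperedCurve.mlfClosurePadic.K).tmPair.M :=
  ⟨genuineOfDoubleUnderlinePadic_of_package C μ hC hS hl hp2 hpl hζ hη hopen h, fun _ => rfl⟩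

end AbsTopMonoids

end Literature.IUT.HodgeArakelov

end
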